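import Literature.NumberTheory.Transcendental.LineODEAlg
import Literature.NumberTheory.Transcendental.SemistableTorsion
import HarnessLib

/-!
# Multiples of algebraic points of `M_κ` and the algebraicity of generator values at `s·v`

Topic: `Literature/NumberTheory/Transcendental`. A small input of the Siegel step (plan item
W4/S4 of the unit `provefact-Literature.NumberTheory.Transcendental.H-b596640137`): the set
`GaGmE.Std.Alg L κ` of logarithms of algebraic points of `M_κ` (`SemistableQuotients.lean`) is
stable under natural multiples (`nsmul_mem_Alg`, from `IsUnivExtAlgPoint.int_mul` of
`UnivExtAlgPoints.lean` — the group law of `E♮` at algebraic points), hence so is `AlgTors`; and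
therefore ALL line-generator values at all multiples `s·v` of a point `v ∈ Alg` are algebraic
(`isAlgebraic_genFun_zero_nsmul`, via `LineODEAlg.isAlgebraic_genFun_zero`). Everything is proved.

## References

* A. Baker, G. Wüstholz, *Logarithmic Forms and Diophantine Geometry*, CUP 2007, §6.8 (p. 119:
  the points `sγ` are algebraic).
-/

noncomputable section

open Complex
open scoped PeriodPair

namespace Literature.NumberTheory.Transcendental

namespace GaGmE

namespace Std

variable {β γ δ : Type} [Fintype β] [Fintype γ] [Fintype δ] [DecidableEq γ]
variable {L : PeriodPair} (κM : δ → γ → Kbar)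

omit [Fintype β] [Fintype δ] [DecidableEq γ] in
/-- **`Alg` is stable under natural multiples.** [folklore] -/
theorem nsmul_mem_Alg (h₂ : IsAlgebraic ℚ L.g₂) (h₃ : IsAlgebraic ℚ L.g₃) {w : β ⊕ (γ ⊕ δ) → ℂ}
    (hw : w ∈ Alg L κM) (n : ℕ) : ((n : ℂ) • w) ∈ Alg L κM := by
  obtain ⟨hy, t', hzt, hs⟩ := hw
  refine ⟨fun j => ?_, fun b => n * t' b, fun b => ?_, fun e => ?_⟩
  · -- torus: `e^{n y} = (e^y)^n`
    have : cexp (((n : ℂ) • w) (iy j)) = cexp (w (iy j)) ^ n := by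
      simp [← Complex.exp_nat_mul]
    rw [this]
    exact (hy j).pow n
  · have := (hzt b).int_mul h₂ h₃ (n : ℤ)
    simpa using this
  · have : ((n : ℂ) • w) (is e) - ∑ b, (κM e b : ℂ) * (n * t' b) =
        (n : ℂ) * (w (is e) - ∑ b, (κM e b : ℂ) * t' b) := by
      simp only [Pi.smul_apply, smul_eq_mul, Finset.mul_sum, mul_sub]
      congr 1
      exact Finset.sum_congr rfl fun b _ => by ring
    rw [this]
    exact (isAlgebraic_nat n).mul (hs e)

omit [Fintype β] [Fintype δ] [DecidableEq γ] in
/-- `AlgTors` is stable under natural multiples. [folklore] -/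
theorem nsmul_mem_AlgTors (h₂ : IsAlgebraic ℚ L.g₂) (h₃ : IsAlgebraic ℚ L.g₃) {w : β ⊕ (γ ⊕ δ) → ℂ}
    (hw : w ∈ AlgTors L κM) (n : ℕ) : ((n : ℂ) • w) ∈ AlgTors L κM := by
  refine ⟨nsmul_mem_Alg κM h₂ h₃ hw.1 n, fun b => ?_⟩
  have := (hw.2 b).int_mul (n : ℤ)
  simpa using this

omit [Fintype β] [Fintype δ] in
/-- **All generator values at all multiples of an algebraic point are algebraic** (adapted
charts). [cite: BakerWustholz2007, §6.8 (p. 119)] -/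
theorem isAlgebraic_genFun_zero_nsmul (h₂ : IsAlgebraic ℚ L.g₂) (h₃ : IsAlgebraic ℚ L.g₃)
    {v : β ⊕ (γ ⊕ δ) → ℂ} (hv : v ∈ Alg L κM) (s : ℕ) (x : β ⊕ (γ ⊕ δ) → ℂ) (i : Gen β γ δ) :
    IsAlgebraic ℚ (genFun L κM (chartChoiceAt L ((s : ℂ) • v)) ((s : ℂ) • v) x 0 i) :=
  isAlgebraic_genFun_zero κM h₂ h₃ _ (nsmul_mem_Alg κM h₂ h₃ hv s) x
    (zero_mem_chartDomain_chartChoiceAt L _ x) i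

end Std

end GaGmE

end Literature.NumberTheory.Transcendental

end
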